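import Mathlib
import Summits.KontsevichZagierPeriods.Zeta5Search.Certificates.RecordRayPhatData
import HarnessLib

/-! # Record ray, (N) for every `n ≥ 1` — identification points 01/12: `j = 30 … 59` (S4-R1 item #10, step N-2c)

30 of the 356 kernel point identities `identAt k` (`RecordRayPhatData`), `k = j − 177`, one theorem per point, each
`decide +kernel` (≈ 3 s; fam-tele's computable mirror `PgenM` of the integer period matrix against `(c0 · Ĝ(k)) • P̂(k)`),
and their assembly `chunk_1` on the index interval `[30, 60)`.  The twelve chunks are concatenated in `RecordRayIdentWindow`.

Provenance: gen-2 g32's kernel-checked scratch `AllN_G15.lean` (2026-08-22, rc 0 / 0 sorry, axioms propext ·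
Classical.choice · Quot.sound), built on fam-tele g15's generic record-ray interface (`RecordRayGenericForms/Steps`,
`RecordRayMirror`, `RecordRayRaySteps`, `RecordRayChain`, all in the tree); data from gen-2 g31 (`P̂`, align) and fam-tele
g14 (`conn/PATH.md`).  Staged for the tree by gen-2 g33 (S4-R1 item #10).

HONEST FRAMING: systematic search; no irrationality claim unless certified; this is clause (N) of Brown–Zudilin's Theorem 1
(arXiv:2210.03391) for THEIR OWN record cell — the non-vanishing of their linear forms — and nothing about ζ(5) beyond that;
records UNMOVED. -/

namespace Summit.KontsevichZagierPeriods.Zeta5Search.RecordRay.Generic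

section Window

/- The point evaluations are memory-hungry kernel reductions (≈ 3 s each); elaborating them in PARALLEL killed a farm
   node twice (gen-2 g32).  Serialize them. -/
set_option Elab.async false

/-- Point identity `PgenM k = (c0 · Ĝ(k)) • P̂(k)` at `k = 30 − 177 = -147` (kernel `decide`). -/
theorem ip_30 : IdP 30 = true := by decide +kernel
/-- Point identity `PgenM k = (c0 · Ĝ(k)) • P̂(k)` at `k = 31 − 177 = -146` (kernel `decide`). -/
theorem ip_31 : IdP 31 = true := by decide +kernel
/-- Point identity `PgenM k = (c0 · Ĝ(k)) • P̂(k)` at `k = 32 − 177 = -145` (kernel `decide`). -/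
theorem ip_32 : IdP 32 = true := by decide +kernel
/-- Point identity `PgenM k = (c0 · Ĝ(k)) • P̂(k)` at `k = 33 − 177 = -144` (kernel `decide`). -/
theorem ip_33 : IdP 33 = true := by decide +kernel
/-- Point identity `PgenM k = (c0 · Ĝ(k)) • P̂(k)` at `k = 34 − 177 = -143` (kernel `decide`). -/
theorem ip_34 : IdP 34 = true := by decide +kernel
/-- Point identity `PgenM k = (c0 · Ĝ(k)) • P̂(k)` at `k = 35 − 177 = -142` (kernel `decide`). -/
theorem ip_35 : IdP 35 = true := by decide +kernel
/-- Point identity `PgenM k = (c0 · Ĝ(k)) • P̂(k)` at `k = 36 − 177 = -141` (kernel `decide`). -/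
theorem ip_36 : IdP 36 = true := by decide +kernel
/-- Point identity `PgenM k = (c0 · Ĝ(k)) • P̂(k)` at `k = 37 − 177 = -140` (kernel `decide`). -/
theorem ip_37 : IdP 37 = true := by decide +kernel
/-- Point identity `PgenM k = (c0 · Ĝ(k)) • P̂(k)` at `k = 38 − 177 = -139` (kernel `decide`). -/
theorem ip_38 : IdP 38 = true := by decide +kernel
/-- Point identity `PgenM k = (c0 · Ĝ(k)) • P̂(k)` at `k = 39 − 177 = -138` (kernel `decide`). -/
theorem ip_39 : IdP 39 = true := by decide +kernel
/-- Point identity `PgenM k = (c0 · Ĝ(k)) • P̂(k)` at `k = 40 − 177 = -137` (kernel `decide`). -/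
theorem ip_40 : IdP 40 = true := by decide +kernel
/-- Point identity `PgenM k = (c0 · Ĝ(k)) • P̂(k)` at `k = 41 − 177 = -136` (kernel `decide`). -/
theorem ip_41 : IdP 41 = true := by decide +kernel
/-- Point identity `PgenM k = (c0 · Ĝ(k)) • P̂(k)` at `k = 42 − 177 = -135` (kernel `decide`). -/
theorem ip_42 : IdP 42 = true := by decide +kernel
/-- Point identity `PgenM k = (c0 · Ĝ(k)) • P̂(k)` at `k = 43 − 177 = -134` (kernel `decide`). -/
theorem ip_43 : IdP 43 = true := by decide +kernel
/-- Point identity `PgenM k = (c0 · Ĝ(k)) • P̂(k)` at `k = 44 − 177 = -133` (kernel `decide`). -/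
theorem ip_44 : IdP 44 = true := by decide +kernel
/-- Point identity `PgenM k = (c0 · Ĝ(k)) • P̂(k)` at `k = 45 − 177 = -132` (kernel `decide`). -/
theorem ip_45 : IdP 45 = true := by decide +kernel
/-- Point identity `PgenM k = (c0 · Ĝ(k)) • P̂(k)` at `k = 46 − 177 = -131` (kernel `decide`). -/
theorem ip_46 : IdP 46 = true := by decide +kernel
/-- Point identity `PgenM k = (c0 · Ĝ(k)) • P̂(k)` at `k = 47 − 177 = -130` (kernel `decide`). -/
theorem ip_47 : IdP 47 = true := by decide +kernel
/-- Point identity `PgenM k = (c0 · Ĝ(k)) • P̂(k)` at `k = 48 − 177 = -129` (kernel `decide`). -/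
theorem ip_48 : IdP 48 = true := by decide +kernel
/-- Point identity `PgenM k = (c0 · Ĝ(k)) • P̂(k)` at `k = 49 − 177 = -128` (kernel `decide`). -/
theorem ip_49 : IdP 49 = true := by decide +kernel
/-- Point identity `PgenM k = (c0 · Ĝ(k)) • P̂(k)` at `k = 50 − 177 = -127` (kernel `decide`). -/
theorem ip_50 : IdP 50 = true := by decide +kernel
/-- Point identity `PgenM k = (c0 · Ĝ(k)) • P̂(k)` at `k = 51 − 177 = -126` (kernel `decide`). -/
theorem ip_51 : IdP 51 = true := by decide +kernel
/-- Point identity `PgenM k = (c0 · Ĝ(k)) • P̂(k)` at `k = 52 − 177 = -125` (kernel `decide`). -/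
theorem ip_52 : IdP 52 = true := by decide +kernel
/-- Point identity `PgenM k = (c0 · Ĝ(k)) • P̂(k)` at `k = 53 − 177 = -124` (kernel `decide`). -/
theorem ip_53 : IdP 53 = true := by decide +kernel
/-- Point identity `PgenM k = (c0 · Ĝ(k)) • P̂(k)` at `k = 54 − 177 = -123` (kernel `decide`). -/
theorem ip_54 : IdP 54 = true := by decide +kernel
/-- Point identity `PgenM k = (c0 · Ĝ(k)) • P̂(k)` at `k = 55 − 177 = -122` (kernel `decide`). -/
theorem ip_55 : IdP 55 = true := by decide +kernel
/-- Point identity `PgenM k = (c0 · Ĝ(k)) • P̂(k)` at `k = 56 − 177 = -121` (kernel `decide`). -/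
theorem ip_56 : IdP 56 = true := by decide +kernel
/-- Point identity `PgenM k = (c0 · Ĝ(k)) • P̂(k)` at `k = 57 − 177 = -120` (kernel `decide`). -/
theorem ip_57 : IdP 57 = true := by decide +kernel
/-- Point identity `PgenM k = (c0 · Ĝ(k)) • P̂(k)` at `k = 58 − 177 = -119` (kernel `decide`). -/
theorem ip_58 : IdP 58 = true := by decide +kernel
/-- Point identity `PgenM k = (c0 · Ĝ(k)) • P̂(k)` at `k = 59 − 177 = -118` (kernel `decide`). -/
theorem ip_59 : IdP 59 = true := by decide +kernel

/-- The point identities for `30 ≤ j < 60` (`k = -147 … -118`), assembled. -/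
theorem chunk_1 : ∀ j : ℕ, 30 ≤ j → j < 60 → IdP j = true :=
  chunk_step ip_30 <| chunk_step ip_31 <| chunk_step ip_32 <| chunk_step ip_33 <| chunk_step ip_34 <|
  chunk_step ip_35 <| chunk_step ip_36 <| chunk_step ip_37 <| chunk_step ip_38 <| chunk_step ip_39 <|
  chunk_step ip_40 <| chunk_step ip_41 <| chunk_step ip_42 <| chunk_step ip_43 <| chunk_step ip_44 <|
  chunk_step ip_45 <| chunk_step ip_46 <| chunk_step ip_47 <| chunk_step ip_48 <| chunk_step ip_49 <|
  chunk_step ip_50 <| chunk_step ip_51 <| chunk_step ip_52 <| chunk_step ip_53 <| chunk_step ip_54 <|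
  chunk_step ip_55 <| chunk_step ip_56 <| chunk_step ip_57 <| chunk_step ip_58 <| chunk_step ip_59 <| chunk_base

end Window

end Summit.KontsevichZagierPeriods.Zeta5Search.RecordRay.Generic
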